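import Literature.AlgebraicGeometry.Resolution.PointBlowupResidueInequality
import Literature.AlgebraicGeometry.Resolution.CentreBlowupMohStability
import HarnessLib

/-!
# Hauser–Perlega's condition (4) in the tree's typed form, and all necessary conditions for an
  increase of the shade at order `pᵉ` under Moh-permissible coordinate centres of any dimension

Topic: `Literature/AlgebraicGeometry/Resolution`. Reproduction (cell `pub-hironaka`, unit
`b2b-hironaka-cp4`, DIM-4 CENSUS gen 16; sequel of `PointBlowupResidueInequality.lean` (points) and
`CentreBlowupMohStability.lean` (the coordinate-centre model `CentreBlowup` of
`PointBlowupShadeCentres.lean`, `e = 1`)) of two remaining pieces of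

* H. Hauser, S. Perlega, *Characterizing the increase of the residual order under blowup in
  positive characteristic*, Publ. RIMS **55** (2019) 835–857 [HauserPerlega2019PRIMS], §3 Theorem —
  stated for "a completed local blowup `π : R → R′` … permissible with respect to `J` and `D` with
  center `Z`", the centre being `P = (z, x_i : i ∈ S)` for a subset `S ⊇ T` of the variables (§2:
  "`x_i ↦ x₁x_i` for `i ∈ S∖T`, `x_i ↦ x_i` for `i ∉ S`"), i.e. for permissible COORDINATE CENTRES
  of any dimension, not only points; assertion (4) "`ord^{mod pᵉ}_{Q_T} F > u`";
* T. T. Moh, *On a stability theorem for local uniformization in characteristic `p`*, Publ. RIMS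
  **23** (1987) 965–973 [Moh1987], whose Stability Theorem (p. 966) is about "a permissible blowup
  with center `P`" ("Definition. An ideal `P` is said to be a permissible center if there is a
  system of parameters `(y₁,…,y_n)` such that (1) all `x_i`'s with `m_i ≠ 0` are among them, (2) a
  part of them generate `P`, (3) `F ∈ P^d` where `d = ord F`", p. 967);
* H. Hauser, *On the problem of resolution of singularities in positive characteristic*, Bull. AMS
  **47** (2010) [Hauser2010], §I p. 23: "It is checked by computation that the condition
  `ord^p_z P⁺ ≥ k + 1` on `P⁺` is a prerequisite for the occurence of a kangaroo point as in the
  theorem", for the sheared polynomial `P⁺(y) = P(y + t·y_m)` cleaned of its `p`-th power monomials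
  — the tree's `Hauser2010.shear`, `Hauser2010.pOrderAwayFrom` and the predicate
  `HauserPerlega2019.Condition4` of `PointBlowupShadeCentres.lean` ("A PREDICATE; 'kangaroo point ⇒
  (4)' is the printed theorem and is not asserted here"). NOTE on the numbering: this ORDER
  PREREQUISITE is what [HP19 PRIMS] call assertion (4); Hauser's own §G Kangaroo Theorem condition (4)
  (p. 18: "The initial form of `g` equals, up to linear coordinate changes and multiplication by `p`th
  powers, a specific homogeneous polynomial, called oblique, which is unique for each choice of `p`,
  `r` and degree") is an existence-and-uniqueness / normal-form statement which is NOT asserted in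
  the tree; wherever this file says "(4)" it means [HP19 PRIMS] (4) = the §I prerequisite.

## What is proved

§1 (points, every natural `q`, no cleanness): **`PointBlowup.condition4_of_shadeIncreases`** — if
the shade increases at the point `b` of the `y_j`-chart (`ord₀ F = o ≥ q`, `y^r ∣ F`), then
`HauserPerlega2019.Condition4 q j b s` holds: `u = o − Σ_{i∈T} r_i <
ord^{mod q}_{≠ j}(shear_{j,b}(In F))` — the tree's own typing of [HP19 PRIMS] (4) = the order
prerequisite of [Ha10] §I p. 23, now a theorem. It is the statement `PointBlowup.dvd_of_shadeIncreases_of_mem_support_dehomog` of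
`PointBlowupResidueInequality.lean` transported along the identity `(shear_{j,b} P)(y_j ↦ 1) =
Φ_{j,b}(P)` (private lemma `flat_shear`) for the homogeneous `P = In F` (the monomials of
`shear_{j,b} P` are `y^m·y_j^{o−|m|}` for the monomials `y^m` of `Φ_{j,b}(P)`, private lemma
`coeff_erase_dehomog_eq_of_mem_support_shear`).

§2 (Moh-permissible coordinate centres `C_S = {x = 0, y_i = 0 (i ∈ S)}`, `j ∈ S`, points `b` of the
fibre over the origin — `b_j = 0`, `b_i = 0` off `S` —, permissibility as in
`CentreBlowupMohStability.lean`: every monomial `y^d` of `F` has `degIn S d ≥ q` and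
`degIn S d ≥ degIn S r + shade`): **`CentreBlowup.shadeIncreases_toState_of_shadeIncreases`** — an
increase of the shade under the blow-up of `C_S` at `(j, b)` implies an increase under the POINT
blow-up at the same `(j, b)` (the comparison `CentreBlowup.shade_step_le_shade_pointStep`, valid for
every natural `q`); hence EVERY necessary condition proved for points holds verbatim for centres,
every `e`, every dimension: `CentreBlowup.mohBound_pow` (Moh's one-blow-up bound `+p^{e−1}` for
permissible coordinate centres of any dimension — the printed generality of [Moh87] p. 966),
`CentreBlowup.dvd_of_shadeIncreases` ((2): `q ∣ ord₀ F`, any natural `q`),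
`CentreBlowup.shade_step_le_of_pow_witness` (a `q`-witness forbids an increase under every
permissible coordinate centre), `CentreBlowup.pow_dvd_apply_of_shadeIncreases_of_nonexceptional`
((7) in fixed coordinates), `CentreBlowup.residueInequality_of_shadeIncreases` /
`…_of_clean` ((6)), `CentreBlowup.exists_two_lost_of_shadeIncreases` (Comment (d)),
`CentreBlowup.condition4_of_shadeIncreases` ((4)).

§3 (appended 2026-08-27): OFF THE CENTRE the exponents of every initial monomial are frozen at the
recorded multiplicities by Moh-permissibility (`CentreBlowup.apply_eq_r_of_not_mem_of_perm`), so (7)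
holds there AS WORDED for the divisor's multiplicities: **`CentreBlowup.pow_dvd_r_of_shadeIncreases_of_not_mem`**
(increase ⇒ `pᵉ ∣ r_i` for every `i ∉ S`) and its contrapositive
**`CentreBlowup.mem_of_shadeIncreases_of_not_pow_dvd`** ("the center is contained in every component
whose multiplicity is not a multiple of `pᵉ`" — the wording of Hironaka's 2011 Prop 33.1 (1), context);
`CentreBlowup.pow_dvd_apply_of_shadeIncreases_of_kept` ((7) in the tangent cone for every kept
variable, exceptional or not).

## What is NOT proved here (scope, honest)

* Only COORDINATE centres through the origin in the given variables and only points of the fibre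
  over the origin (the reading notes of `CentreBlowupMohStability.lean` apply verbatim: Moh's centres
  are coordinate in HIS adapted parameters; no re-coordinatisation is modelled); the converse
  Comment (g); the sequence statements of `PointBlowupResidueInequality.lean` §5 for mixed
  centre/point sequences (the comparison is one-step).
* Nothing here is a statement about resolution of singularities; census value only (row O5 of the
  dimension-4 census of `pub-hironaka`: "Taking larger centers would prevent the phenomenon from
  happening" ([HauserPerlega2019, §1]) concerns the long-run behaviour at `e ≥ 3`; for ONE blow-up,
  a larger Moh-permissible coordinate centre satisfies every necessary condition a point blow-up
  does, at every `e`, in every dimension — kernel-checked).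

AI-assisted formalisation (pub-hironaka cell); the informal gloss above is the cell's reading of
the cited pages, the Lean statements are what is certified.
-/

noncomputable section

open MvPolynomial Finset

open scoped BigOperators

namespace Literature.AlgebraicGeometry.Resolution

open Literature.AlgebraicGeometry.Resolution.Hauser2010
open Literature.Barriers.ResolutionOfSingularities

/-! ## 1. Condition (4) in the tree's typed form (`Hauser2010.shear`, `pOrderAwayFrom`) -/

namespace PointBlowup

section Shear

variable {σ : Type*} {K : Type*} [Field K] [Fintype σ] [DecidableEq σ]

/-- The shear `y_i ↦ y_i + t_i y_j` (`i ≠ j`), `y_j ↦ y_j` preserves homogeneity: every monomial of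
`shear j t P` has degree `o` if every monomial of `P` has. [folklore] -/
private theorem degree_eq_of_mem_support_shear (j : σ) (t : σ → K) (P : MvPolynomial σ K) {o : ℕ}
    (hP : ∀ d ∈ P.support, d.degree = o) :
    ∀ E ∈ (shear j t P).support, E.degree = o := by
  classical
  unfold shear
  conv => enter [E, 1]; rw [P.as_sum, map_sum]
  refine forall_support_sum _ _ fun d hd => ?_
  rw [aeval_monomial, algebraMap_eq, Finsupp.prod_pow]
  have hfac : ∀ i ∈ (univ : Finset σ), ∀ m ∈ ((if i = j then (X j : MvPolynomial σ K)
      else X i + C (t i) * X j) ^ (d i)).support, m.degree = d i := by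
    intro i _
    have h1 : ∀ m ∈ (if i = j then (X j : MvPolynomial σ K) else X i + C (t i) * X j).support,
        m.degree = 1 := by
      split_ifs
      · exact forall_support_X (P := fun m => m.degree = 1) (Finsupp.degree_single _ _)
      · refine forall_support_add (forall_support_X (P := fun m => m.degree = 1)
          (Finsupp.degree_single _ _)) ?_
        rw [← monomial_zero', X, monomial_mul, zero_add, mul_one]
        exact forall_support_monomial (P := fun m => m.degree = 1) (Finsupp.degree_single _ _) _
    have := forall_support_pow (P := fun n m => m.degree = n) (n := 1) (by rw [map_zero])
      (fun _ _ a c ha hc => by rw [map_add, ha, hc]) h1 (d i)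
    rwa [mul_one] at this
  have hprod := forall_support_prod (P := fun n m => m.degree = n) (by rw [map_zero])
    (fun _ _ a c ha hc => by rw [map_add, ha, hc]) univ _ (fun i => d i) hfac
  have hC : ∀ m ∈ (C (coeff d P) : MvPolynomial σ K).support, m.degree = 0 :=
    forall_support_C (P := fun m => m.degree = 0) (by rw [map_zero]) _
  refine forall_support_mul (P := fun m => m.degree = 0) (Q := fun m => m.degree = ∑ i, d i)
    (S := fun m => m.degree = o) (fun a c ha hc => ?_) hC hprod
  rw [map_add, ha, hc, zero_add, ← Finsupp.degree_eq_sum, hP d hd]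

omit [Fintype σ] in
/-- `(shear_{j,t} P)(y_j ↦ 1) = Φ_{j,t}(P)`: dehomogenising the sheared polynomial in the chart `y_j`
is the dehomogenisation-with-translation of `PointBlowupResidueInequality.lean`. [folklore] -/
private theorem flat_shear (j : σ) (t : σ → K) (P : MvPolynomial σ K) :
    aeval (fun i => if i = j then (1 : MvPolynomial σ K) else X i) (shear j t P) =
      aeval (fun i => if i = j then (1 : MvPolynomial σ K) else X i + C (t i)) P := by
  unfold shear
  rw [← AlgHom.comp_apply, MvPolynomial.comp_aeval]
  have hfun : (fun i => aeval (fun i => if i = j then (1 : MvPolynomial σ K) else X i)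
      (if i = j then (X j : MvPolynomial σ K) else X i + C (t i) * X j)) =
      fun i => if i = j then (1 : MvPolynomial σ K) else X i + C (t i) := by
    funext i
    by_cases hij : i = j
    · rw [if_pos hij, if_pos hij, aeval_X, if_pos rfl]
    · rw [if_neg hij, if_neg hij, map_add, map_mul, aeval_X, aeval_X, aeval_C, if_neg hij,
        if_pos rfl, mul_one, algebraMap_eq]
  rw [hfun]

omit [Fintype σ] [DecidableEq σ] in
/-- `|E − E_j e_j| + E_j = |E|`. [folklore] -/
private theorem degree_erase_add_apply (j : σ) (E : σ →₀ ℕ) : (E.erase j).degree + E j = E.degree := by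
  conv_rhs => rw [← Finsupp.erase_add_single j E]
  rw [map_add, Finsupp.degree_single]

/-- **The monomials of the sheared initial form are those of its dehomogenisation**: for `P`
homogeneous of degree `o`, if `y^E` is a monomial of `shear_{j,b} P` then `y^{E − E_j e_j}` is a
monomial of `Φ_{j,b}(P)` with the same coefficient (and degree `|E| − E_j`). [folklore] -/
private theorem coeff_erase_dehomog_eq_of_mem_support_shear (j : σ) (b : σ → K) (P : MvPolynomial σ K)
    {o : ℕ} (hP : ∀ d ∈ P.support, d.degree = o) {E : σ →₀ ℕ} (hE : E ∈ (shear j b P).support) :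
    coeff (E.erase j) (aeval (fun i => if i = j then (1 : MvPolynomial σ K) else X i + C (b i)) P) =
      coeff E (shear j b P) := by
  rw [← flat_shear]
  exact coeff_erase_flat_of_isHomogeneous j (shear j b P) (degree_eq_of_mem_support_shear j b P hP) hE

variable [DecidableEq K]

/-- **[HP19 PRIMS] assertion (4) — the order prerequisite "`ord^p_z P⁺ ≥ k + 1`" of [Ha10] §I p. 23
— as the tree's predicate `HauserPerlega2019.Condition4`.** If the shade increases at the point `b`
of the `y_j`-chart (`ord₀ F = o ≥ q`, `y^r ∣ F`, `b_j = 0`), then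
`u < ord^{mod q}_{≠ j}(shear_{j,b}(In F))` with `u = o − Σ_{i ∈ T} r_i`
(`HauserPerlega2019.residualDegree`), i.e. `Condition4 q j b s`: the initial form, sheared by the
translation vector of the point and cleaned of its `q`-th-power monomials, has order `> u` in the
variables other than `y_j` — "`ord^{mod pᵉ}_{Q_T} F > u`" ([HP19 PRIMS] (4)), "the condition
`ord^p_z P⁺ ≥ k + 1` on `P⁺` is a prerequisite for the occurence of a kangaroo point" ([Ha10] §I
p. 23). Every natural `q`; no cleanness, equimultiplicity or perfectness hypothesis. The predicate
was typed in `PointBlowupShadeCentres.lean` with the remark "'kangaroo point ⇒ (4)' is the printed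
theorem and is not asserted here"; this is its proof. NOT asserted: Hauser's §G Kangaroo Theorem
condition (4) proper (p. 18), the oblique NORMAL FORM of the initial form of `g`, unique up to linear
coordinate changes and `p`-th powers for each `(p, r, degree)`.
[cite: HauserPerlega2019PRIMS, §3 Theorem (4)] [cite: Hauser2010, §I p. 23 (ord^p_z P⁺ ≥ k + 1)] -/
theorem condition4_of_shadeIncreases (q : ℕ) (j : σ) (b : σ → K) (hbj : b j = 0) (s : State σ K)
    {o : ℕ} (ho : ordZero s.F = o) (hqo : q ≤ o) (hr : ∀ d ∈ s.F.support, s.r ≤ d)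
    (hinc : ShadeIncreases q j b s) : HauserPerlega2019.Condition4 q j b s := by
  classical
  unfold HauserPerlega2019.Condition4 HauserPerlega2019.ObliqueOrderCondition
    HauserPerlega2019.residualDegree HauserPerlega2019.initialForm pOrderAwayFrom orderAwayFrom
  rw [ho, ENat.toNat_coe]
  set P : MvPolynomial σ K := homogeneousComponent o s.F with hPdef
  have hP : ∀ d ∈ P.support, d.degree = o := by
    intro d hd
    rw [MvPolynomial.mem_support_iff, hPdef, coeff_homogeneousComponent] at hd
    by_contra h
    exact hd (if_neg h)
  -- `q ∣ o` (Probe 1)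
  have hqo' : q ∣ o := by
    by_contra hndvd
    exact absurd hinc (not_lt.mpr (shade_step_le_of_not_dvd q j b hbj s ho hqo hr hndvd))
  -- `Σ_{i∈T} r_i ≤ o`
  obtain ⟨⟨d₀, hd₀, hd₀deg⟩, -⟩ := (ordZero_eq_nat_iff _ _).mp ho
  have hsum : ∑ i ∈ lostComponents j b, s.r i ≤ o := by
    calc ∑ i ∈ lostComponents j b, s.r i ≤ ∑ i ∈ lostComponents j b, d₀ i :=
          Finset.sum_le_sum fun i _ =>
            Finsupp.le_def.mp (hr d₀ (MvPolynomial.mem_support_iff.mpr hd₀)) i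
      _ ≤ ∑ i, d₀ i :=
          Finset.sum_le_sum_of_subset_of_nonneg (Finset.subset_univ _) fun _ _ _ => Nat.zero_le _
      _ = o := by rw [← Finsupp.degree_eq_sum, hd₀deg]
  refine (Finset.lt_inf_iff (WithTop.coe_lt_top _)).mpr fun E hE => ?_
  rw [MvPolynomial.mem_support_iff, coeff_deletePthPowers] at hE
  by_cases hpth : IsPthPowerExponent q E
  · exact absurd (if_pos hpth) hE
  rw [if_neg hpth] at hE
  have hE' : E ∈ (shear j b P).support := MvPolynomial.mem_support_iff.mpr hE
  -- the monomial `E − E_j e_j` of `Φ_{j,b}(In F)`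
  have hm : E.erase j ∈ (aeval (fun i => if i = j then (1 : MvPolynomial σ K) else X i + C (b i))
      P).support := by
    rw [MvPolynomial.mem_support_iff, coeff_erase_dehomog_eq_of_mem_support_shear j b P hP hE']
    exact hE
  have hEdeg : E.degree = o := degree_eq_of_mem_support_shear j b P hP E hE'
  have herase := degree_erase_add_apply j E
  by_contra hle
  rw [not_lt] at hle
  have hle' : E.degree - E j ≤ o - ∑ i ∈ lostComponents j b, s.r i := by exact_mod_cast hle
  have hdvd := dvd_of_shadeIncreases_of_mem_support_dehomog q j b hbj s ho hqo hr hinc hm (by omega)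
  apply hpth
  rw [isPthPowerExponent_iff]
  intro i
  by_cases hij : i = j
  · subst hij
    have h1 : q ∣ (E.erase i).degree := dvd_degree_of_forall_dvd hdvd
    have h2 : E i = o - (E.erase i).degree := by omega
    rw [h2]
    exact Nat.dvd_sub hqo' h1
  · have := hdvd i
    rwa [Finsupp.erase_apply, if_neg hij] at this

end Shear

end PointBlowup

/-! ## 2. Moh-permissible coordinate centres of any dimension: every necessary condition transfers -/

namespace CentreBlowup

variable {σ : Type*} {K : Type*} [Field K] [Fintype σ] [DecidableEq σ] [DecidableEq K]
variable (p : ℕ) [hp : Fact p.Prime] [CharP K p]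

omit hp [CharP K p] in
/-- **An increase under the blow-up of a Moh-permissible coordinate centre is an increase under the
point blow-up with the same chart and point.** For every natural `q`: if `C_S` is Moh-permissible
for `s = (F, r)` (`degIn S d ≥ q` and `degIn S d ≥ degIn S r + shade` for every monomial `y^d` of
`F`), `j ∈ S`, `b` a point of the fibre over the origin (`b_j = 0`, `b_i = 0` off `S`), and the
shade increases under the `C_S`-step at `(j, b)`, then `PointBlowup.ShadeIncreases q j b (F, r)`
(by `shade_step_le_shade_pointStep`). [cite: Moh1987, Stability Theorem (p. 966) and Definition (p. 967)]
[cite: HauserPerlega2019PRIMS, §2 (the centre P = (z, x_i : i ∈ S), S ⊇ T)] -/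
theorem shadeIncreases_toState_of_shadeIncreases (q : ℕ) {S : Finset σ} {j : σ} (hj : j ∈ S)
    (b : σ → K) (hbj : b j = 0) (hbN : ∀ i, i ∉ S → b i = 0) (s : CState σ K) {o : ℕ}
    (ho : ordZero s.F = o) (hr : ∀ d ∈ s.F.support, s.r ≤ d)
    (hq : ∀ d ∈ s.F.support, q ≤ degIn S d)
    (hperm : ∀ d ∈ s.F.support, degIn S s.r + (o - s.r.degree) ≤ degIn S d)
    (hinc : ShadeIncreases q S j b s) : PointBlowup.ShadeIncreases q j b s.toState := by
  unfold PointBlowup.ShadeIncreases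
  unfold ShadeIncreases at hinc
  rw [CState.shade_toState]
  exact lt_of_lt_of_le hinc (shade_step_le_shade_pointStep q hj b hbj hbN s ho hr hq hperm)

/-- **Moh's one-blow-up bound at order `pᵉ` for Moh-permissible coordinate centres of any dimension,
every `e ≥ 1`, every dimension**: `shade(step) ≤ shade + p^{e−1}` — "After a permissible blowup …
`ord F̄ ≤ d + p^{e−1}`" ([Moh87] p. 966) in its printed generality (centres of any dimension), for the
coordinate centres of the model; transferred from `PointBlowup.mohBound` by the comparison of shades.
[cite: Moh1987, Stability Theorem (one permissible blow-up, p. 966)] [cite: HauserPerlega2019PRIMS, §3 Theorem (9)] -/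
theorem mohBound_pow {e : ℕ} (he : 1 ≤ e) {S : Finset σ} {j : σ} (hj : j ∈ S) (b : σ → K)
    (hbj : b j = 0) (hbN : ∀ i, i ∉ S → b i = 0) (s : CState σ K)
    (hclean : deletePthPowers (p ^ e) s.F = s.F) {o : ℕ} (ho : ordZero s.F = o)
    (hr : ∀ d ∈ s.F.support, s.r ≤ d) (hq : ∀ d ∈ s.F.support, p ^ e ≤ degIn S d)
    (hperm : ∀ d ∈ s.F.support, degIn S s.r + (o - s.r.degree) ≤ degIn S d) :
    (step (p ^ e) S j b s).shade ≤ s.shade + ((p ^ (e - 1) : ℕ) : ℕ∞) := by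
  obtain ⟨hqo, -, -⟩ := le_of_forall_le_degIn S s ho hr hperm hq
  have hM := PointBlowup.mohBound p he j b hbj s.toState hclean (by
    show ((p ^ e : ℕ) : ℕ∞) ≤ ordZero s.F
    rw [ho]; exact_mod_cast hqo) hr
  unfold PointBlowup.MohBound at hM
  rw [CState.shade_toState] at hM
  exact le_trans (shade_step_le_shade_pointStep (p ^ e) hj b hbj hbN s ho hr hq hperm) hM

/-- **(2) for centres**: an increase under a Moh-permissible coordinate centre forces `q ∣ ord₀ F`
(`q = pᵉ`; in fact any natural `q`). [cite: HauserPerlega2019PRIMS, §3 Theorem (2)] -/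
theorem dvd_of_shadeIncreases (q : ℕ) {S : Finset σ} {j : σ} (hj : j ∈ S) (b : σ → K)
    (hbj : b j = 0) (hbN : ∀ i, i ∉ S → b i = 0) (s : CState σ K) {o : ℕ} (ho : ordZero s.F = o)
    (hr : ∀ d ∈ s.F.support, s.r ≤ d) (hq : ∀ d ∈ s.F.support, q ≤ degIn S d)
    (hperm : ∀ d ∈ s.F.support, degIn S s.r + (o - s.r.degree) ≤ degIn S d)
    (hinc : ShadeIncreases q S j b s) : q ∣ o := by
  obtain ⟨hqo, -, -⟩ := le_of_forall_le_degIn S s ho hr hperm hq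
  have h := shadeIncreases_toState_of_shadeIncreases q hj b hbj hbN s ho hr hq hperm hinc
  by_contra hndvd
  exact absurd h (not_lt.mpr (PointBlowup.shade_step_le_of_not_dvd q j b hbj s.toState ho hqo hr hndvd))

/-- **A `q`-witness forbids an increase under every Moh-permissible coordinate centre** (`q = pᵉ`,
every `e`, every chart `j ∈ S`, every point of the fibre, every dimension): the centre version of
`PointBlowup.shade_step_le_of_pow_witness` (Moh's cases (1)–(2), p. 972, "factor out `x_i`" for the
centre `P ∋ x_s` of any dimension). [cite: Moh1987, §1 (p. 972)] -/
theorem shade_step_le_of_pow_witness {e : ℕ} {S : Finset σ} {j : σ} (hj : j ∈ S) (b : σ → K)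
    (hbj : b j = 0) (hbN : ∀ i, i ∉ S → b i = 0) (s : CState σ K) {o : ℕ} (ho : ordZero s.F = o)
    (hr : ∀ d ∈ s.F.support, s.r ≤ d) (hq : ∀ d ∈ s.F.support, p ^ e ≤ degIn S d)
    (hperm : ∀ d ∈ s.F.support, degIn S s.r + (o - s.r.degree) ≤ degIn S d)
    {i₀ : σ} (hri₀ : s.r i₀ = 0) {d₀ : σ →₀ ℕ} (hd₀ : d₀ ∈ s.F.support) (hd₀deg : d₀.degree = o)
    (hd₀i : ¬ p ^ e ∣ d₀ i₀) : (step (p ^ e) S j b s).shade ≤ s.shade := by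
  obtain ⟨hqo, -, -⟩ := le_of_forall_le_degIn S s ho hr hperm hq
  have h := PointBlowup.shade_step_le_of_pow_witness p j b hbj s.toState ho hqo hr hri₀ hd₀ hd₀deg hd₀i
  rw [CState.shade_toState] at h
  exact le_trans (shade_step_le_shade_pointStep (p ^ e) hj b hbj hbN s ho hr hq hperm) h

/-- **(7) in fixed coordinates, for centres**: after an increase under a Moh-permissible coordinate
centre, every NON-exceptional variable occurs in the initial form with `q`-divisible exponents only.
[cite: HauserPerlega2019PRIMS, §3 Theorem (7)] -/
theorem pow_dvd_apply_of_shadeIncreases_of_nonexceptional {e : ℕ} {S : Finset σ} {j : σ}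
    (hj : j ∈ S) (b : σ → K) (hbj : b j = 0) (hbN : ∀ i, i ∉ S → b i = 0) (s : CState σ K)
    {o : ℕ} (ho : ordZero s.F = o) (hr : ∀ d ∈ s.F.support, s.r ≤ d)
    (hq : ∀ d ∈ s.F.support, p ^ e ≤ degIn S d)
    (hperm : ∀ d ∈ s.F.support, degIn S s.r + (o - s.r.degree) ≤ degIn S d)
    (hinc : ShadeIncreases (p ^ e) S j b s) {i : σ} (hri : s.r i = 0) {d : σ →₀ ℕ}
    (hd : d ∈ s.F.support) (hddeg : d.degree = o) : p ^ e ∣ d i := by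
  obtain ⟨hqo, -, -⟩ := le_of_forall_le_degIn S s ho hr hperm hq
  exact PointBlowup.pow_dvd_apply_of_shadeIncreases_of_nonexceptional p j b hbj s.toState ho hqo hr
    (shadeIncreases_toState_of_shadeIncreases (p ^ e) hj b hbj hbN s ho hr hq hperm hinc) hri hd hddeg

/-- **(6) for centres**: an increase under a Moh-permissible coordinate centre at `(j, b)` forces the
residue inequality `Σ_{i∈T} (r_i mod p^{k+1}) ≤ (b − 1)·p^{k+1}` of the lost components
`T = {j} ∪ {i : b_i ≠ 0}`, at every level `k < e` at which the initial form has an exponent not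
divisible by `p^{k+1}`. [cite: HauserPerlega2019PRIMS, §3 Theorem (6)] -/
theorem residueInequality_of_shadeIncreases {e : ℕ} {S : Finset σ} {j : σ} (hj : j ∈ S)
    (b : σ → K) (hbj : b j = 0) (hbN : ∀ i, i ∉ S → b i = 0) (s : CState σ K) {o : ℕ}
    (ho : ordZero s.F = o) (hr : ∀ d ∈ s.F.support, s.r ≤ d)
    (hq : ∀ d ∈ s.F.support, p ^ e ≤ degIn S d)
    (hperm : ∀ d ∈ s.F.support, degIn S s.r + (o - s.r.degree) ≤ degIn S d)
    (hinc : ShadeIncreases (p ^ e) S j b s) {k : ℕ} (hk : k < e)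
    (hlevel : ∃ d ∈ s.F.support, d.degree = o ∧ ∃ i, ¬ p ^ (k + 1) ∣ d i) :
    HauserPerlega2019.ResidueInequality p k (PointBlowup.lostComponents j b) s.r := by
  obtain ⟨hqo, -, -⟩ := le_of_forall_le_degIn S s ho hr hperm hq
  exact PointBlowup.residueInequality_of_shadeIncreases p j b hbj s.toState ho hqo hr
    (shadeIncreases_toState_of_shadeIncreases (p ^ e) hj b hbj hbN s ho hr hq hperm hinc) hk hlevel

/-- **(6) at the top level `q` for a cleaned state, centres.** [cite: HauserPerlega2019PRIMS, §3 Theorem (6)] -/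
theorem residueInequality_of_shadeIncreases_of_clean {e : ℕ} (he : 1 ≤ e) {S : Finset σ} {j : σ}
    (hj : j ∈ S) (b : σ → K) (hbj : b j = 0) (hbN : ∀ i, i ∉ S → b i = 0) (s : CState σ K)
    (hclean : deletePthPowers (p ^ e) s.F = s.F) {o : ℕ} (ho : ordZero s.F = o)
    (hr : ∀ d ∈ s.F.support, s.r ≤ d) (hq : ∀ d ∈ s.F.support, p ^ e ≤ degIn S d)
    (hperm : ∀ d ∈ s.F.support, degIn S s.r + (o - s.r.degree) ≤ degIn S d)
    (hinc : ShadeIncreases (p ^ e) S j b s) :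
    HauserPerlega2019.ResidueInequality p (e - 1) (PointBlowup.lostComponents j b) s.r := by
  obtain ⟨hqo, -, -⟩ := le_of_forall_le_degIn S s ho hr hperm hq
  exact PointBlowup.residueInequality_of_shadeIncreases_of_clean p he j b hbj s.toState hclean ho hqo hr
    (shadeIncreases_toState_of_shadeIncreases (p ^ e) hj b hbj hbN s ho hr hq hperm hinc)

/-- **Comment (d) for centres**: an increase under a Moh-permissible coordinate centre loses (at
least) two exceptional components, both with multiplicity not divisible by `q` — i.e. there are two
distinct indices, each the chart's or translated, with `q ∤ r_i`. [cite: HauserPerlega2019PRIMS, §3 Comment (d)]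
[cite: HauserPerlega2024, §4 (p. 777)] -/
theorem exists_two_lost_of_shadeIncreases {e : ℕ} (he : 1 ≤ e) {S : Finset σ} {j : σ}
    (hj : j ∈ S) (b : σ → K) (hbj : b j = 0) (hbN : ∀ i, i ∉ S → b i = 0) (s : CState σ K)
    (hclean : deletePthPowers (p ^ e) s.F = s.F) {o : ℕ} (ho : ordZero s.F = o)
    (hr : ∀ d ∈ s.F.support, s.r ≤ d) (hq : ∀ d ∈ s.F.support, p ^ e ≤ degIn S d)
    (hperm : ∀ d ∈ s.F.support, degIn S s.r + (o - s.r.degree) ≤ degIn S d)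
    (hinc : ShadeIncreases (p ^ e) S j b s) :
    ∃ i₁ i₂ : σ, i₁ ≠ i₂ ∧ (i₁ = j ∨ b i₁ ≠ 0) ∧ (i₂ = j ∨ b i₂ ≠ 0) ∧
      ¬ p ^ e ∣ s.r i₁ ∧ ¬ p ^ e ∣ s.r i₂ := by
  obtain ⟨hqo, -, -⟩ := le_of_forall_le_degIn S s ho hr hperm hq
  exact PointBlowup.exists_two_lost_of_shadeIncreases p he j b hbj s.toState hclean ho hqo hr
    (shadeIncreases_toState_of_shadeIncreases (p ^ e) hj b hbj hbN s ho hr hq hperm hinc)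

omit hp [CharP K p] in
/-- **(4) for centres**: an increase under a Moh-permissible coordinate centre at `(j, b)` forces
`HauserPerlega2019.Condition4 q j b (F, r)` (any natural `q`).
[cite: HauserPerlega2019PRIMS, §3 Theorem (4)] -/
theorem condition4_of_shadeIncreases (q : ℕ) {S : Finset σ} {j : σ} (hj : j ∈ S) (b : σ → K)
    (hbj : b j = 0) (hbN : ∀ i, i ∉ S → b i = 0) (s : CState σ K) {o : ℕ} (ho : ordZero s.F = o)
    (hr : ∀ d ∈ s.F.support, s.r ≤ d) (hq : ∀ d ∈ s.F.support, q ≤ degIn S d)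
    (hperm : ∀ d ∈ s.F.support, degIn S s.r + (o - s.r.degree) ≤ degIn S d)
    (hinc : ShadeIncreases q S j b s) : HauserPerlega2019.Condition4 q j b s.toState := by
  obtain ⟨hqo, -, -⟩ := le_of_forall_le_degIn S s ho hr hperm hq
  exact PointBlowup.condition4_of_shadeIncreases q j b hbj s.toState ho hqo hr
    (shadeIncreases_toState_of_shadeIncreases q hj b hbj hbN s ho hr hq hperm hinc)

/-! ## 3. Off the centre: exponents frozen, hence (7) AS WORDED for the divisor's multiplicities
(Hironaka's "the center `D` is contained in every `Γ_j`", 2011 Prop 33.1 (1)) — appended 2026-08-27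

[HP19 PRIMS] §3 Theorem (7) reads "For `j ∉ T`, the variables `x_j` appear only as `pᵉ`-th powers in
`F(x)`"; the indices `j ∉ T` comprise the centre variables whose strict transform passes through the
new point (`j ∈ S ∖ T`) AND the variables off the centre (`j ∉ S`, "`x_i ↦ x_i` for `i ∉ S`", §2).
For the latter Moh-permissibility of `C_S` (every monomial `y^d` of `F = y^r·g` has
`degIn S d ≥ degIn S r + shade`, [Moh87] p. 967 (3) for the residual factor) FREEZES the off-centre
exponents of every initial monomial at the recorded multiplicities (`apply_eq_r_of_not_mem_of_perm`:
`d_i = r_i` for `i ∉ S`), so the tangent-cone form of (7) (`q ∣ d_i`, `pow_dvd_apply_of_shadeIncreases_of_kept`, transferred from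
the point case by `shadeIncreases_toState_of_shadeIncreases`) becomes a statement about the DIVISOR'S
multiplicities themselves: after an increase of the shade under a Moh-permissible coordinate centre,
`pᵉ ∣ r_i` for every variable `i` off the centre — equivalently, every exceptional component whose
multiplicity is NOT a multiple of `pᵉ` contains the centre (`mem_of_shadeIncreases_of_not_pow_dvd`).
This is, in the model, the wording of H. Hironaka's 2011 manuscript (Tordesillas, unrefereed earlier
version of the programme — CONTEXT only, bib `Hironaka2011Tordesillas`), Prop. 33.1 (1) p. 82:
"( T. Moh and H. Hauser ) Assume that `ξ′` is a metastable singular point of `G′` for `π`. Then we have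
(1) the center `D` is contained in every `Γ_j` for `1 ≤ j ≤ t`" (the `Γ_j` being the components carrying
the `qΓ`-cofactor variables `v_j`, `0 < δ_j < q`, Def. 19.1–19.2 p. 28, i.e. `q ∤ ord_{Γ_j} G`; a
"metastable point" is (33.1) p. 81 "`resord_{ξ′}(G′) > resord_ξ(G)` while `ord_ξ(Ǧ) = ord_D(Ǧ)`", the
second clause = equimultiplicity of the residual along `D` = the hypothesis `hperm`).  By contrast the
companion clause (2) / Hauser's (3) for the components INSIDE the centre holds in the tangent-cone
reading only and FAILS as worded for three residual variables
(`PointBlowup.exists_isKangarooPoint_not_hauserConditions`): inside the centre the exponents of a kept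
variable in the initial form may exceed its multiplicity, off the centre they may not.  Model scope as in
§2 (coordinate centres through the origin, points of the fibre over the origin, fixed coordinates). -/

omit [DecidableEq K] hp [CharP K p] in
/-- **Off-centre exponents are frozen under Moh-permissibility**: if every monomial `y^d` of
`F = y^r·g` satisfies `degIn S d ≥ degIn S r + shade` ([Moh87] (3) "`F ∈ P^d`" for the residual
factor, i.e. `C_S` lies in the equimultiple locus of `g`), then every INITIAL monomial
(`|d| = ord₀ F`) has `d_i = r_i` for every variable `i ∉ S`. [cite: Moh1987, §1 (Definition of a permissible center, p. 967)] -/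
theorem apply_eq_r_of_not_mem_of_perm {S : Finset σ} (s : CState σ K) {o : ℕ}
    (ho : ordZero s.F = o) (hr : ∀ d ∈ s.F.support, s.r ≤ d)
    (hperm : ∀ d ∈ s.F.support, degIn S s.r + (o - s.r.degree) ≤ degIn S d)
    {d : σ →₀ ℕ} (hd : d ∈ s.F.support) (hddeg : d.degree = o) {i : σ} (hi : i ∉ S) :
    d i = s.r i := by
  classical
  have hS := (ordAlong_eq_of_perm S s ho hr hperm).2 d hd hddeg
  have h1 := degIn_add_sum_compl S d
  have h2 := degIn_add_sum_compl S s.r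
  have h4 : s.r.degree ≤ d.degree := PointBlowup.degree_le_degree_of_le (hr d hd)
  have hle : ∀ k ∈ Sᶜ, s.r k ≤ d k := fun k _ => Finsupp.le_def.mp (hr d hd) k
  have hsum : ∑ k ∈ Sᶜ, s.r k = ∑ k ∈ Sᶜ, d k := by omega
  exact ((Finset.sum_eq_sum_iff_of_le hle).mp hsum i (Finset.mem_compl.mpr hi)).symm

/-- **[HP19 PRIMS] (7) for the components the new point stays on, centre version** (every `e`, every
dimension): after an increase of the shade under a Moh-permissible coordinate centre `C_S` at the point
`b` of the `y_j`-chart, every variable `y_i` (`i ≠ j`) with `b_i = 0` — the centre variables whose strict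
transform passes through the new point, and all variables off the centre — occurs in the initial form of
`F` with `pᵉ`-divisible exponents only. (The point version is `PointBlowup.pow_dvd_apply_of_shadeIncreases_of_kept` of
`PointBlowupHauserConditions.lean`, downstream of this file, whence the four-line proof is repeated here on the
transferred increase; the special case `r_i = 0` is `pow_dvd_apply_of_shadeIncreases_of_nonexceptional`.)
[cite: HauserPerlega2019PRIMS, §3 Theorem (7)] [cite: Hauser2010, §G Kangaroo Theorem (3)] -/
theorem pow_dvd_apply_of_shadeIncreases_of_kept {e : ℕ} {S : Finset σ} {j : σ} (hj : j ∈ S)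
    (b : σ → K) (hbj : b j = 0) (hbN : ∀ i, i ∉ S → b i = 0) (s : CState σ K) {o : ℕ}
    (ho : ordZero s.F = o) (hr : ∀ d ∈ s.F.support, s.r ≤ d)
    (hq : ∀ d ∈ s.F.support, p ^ e ≤ degIn S d)
    (hperm : ∀ d ∈ s.F.support, degIn S s.r + (o - s.r.degree) ≤ degIn S d)
    (hinc : ShadeIncreases (p ^ e) S j b s) {i : σ} (hij : i ≠ j) (hbi : b i = 0) {d : σ →₀ ℕ}
    (hd : d ∈ s.F.support) (hddeg : d.degree = o) : p ^ e ∣ d i := by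
  obtain ⟨hqo, -, -⟩ := le_of_forall_le_degIn S s ho hr hperm hq
  have hincP := shadeIncreases_toState_of_shadeIncreases (p ^ e) hj b hbj hbN s ho hr hq hperm hinc
  unfold PointBlowup.ShadeIncreases at hincP
  by_contra hndvd
  obtain ⟨k, hk, hk0⟩ := exists_natCast_choose_prime_pow_ne_zero p K hndvd
  exact absurd (PointBlowup.shade_step_le_of_choose_ne_zero p j b hbj s.toState ho hqo hr hij (Or.inl hbi)
    hk hd hddeg hk0) (not_le.mpr hincP)

/-- **(7) off the centre, AS WORDED with the divisor's multiplicities** (every `e`, every dimension):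
after an increase of the shade under a Moh-permissible coordinate centre `C_S`, the multiplicity `r_i`
of EVERY variable off the centre is divisible by `pᵉ` — the off-centre exponents of the initial form
being frozen at `r_i` (`apply_eq_r_of_not_mem_of_perm`).  In the model this is the wording of
Prop. 33.1 (1) of Hironaka's 2011 manuscript ("the center `D` is contained in every `Γ_j`", `Γ_j` the
components with `q ∤ ord_{Γ_j} G`; context class, `Hironaka2011Tordesillas` p. 82), attributed there to
"( T. Moh and H. Hauser )". [cite: HauserPerlega2019PRIMS, §3 Theorem (7)] [cite: Moh1987, §1 (p. 967)] -/
theorem pow_dvd_r_of_shadeIncreases_of_not_mem {e : ℕ} {S : Finset σ} {j : σ} (hj : j ∈ S)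
    (b : σ → K) (hbj : b j = 0) (hbN : ∀ i, i ∉ S → b i = 0) (s : CState σ K) {o : ℕ}
    (ho : ordZero s.F = o) (hr : ∀ d ∈ s.F.support, s.r ≤ d)
    (hq : ∀ d ∈ s.F.support, p ^ e ≤ degIn S d)
    (hperm : ∀ d ∈ s.F.support, degIn S s.r + (o - s.r.degree) ≤ degIn S d)
    (hinc : ShadeIncreases (p ^ e) S j b s) {i : σ} (hi : i ∉ S) : p ^ e ∣ s.r i := by
  classical
  obtain ⟨⟨d₀, hd₀, hd₀deg⟩, -⟩ := (ordZero_eq_nat_iff _ _).mp ho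
  have hd₀s : d₀ ∈ s.F.support := MvPolynomial.mem_support_iff.mpr hd₀
  have hij : i ≠ j := fun h => hi (h ▸ hj)
  rw [← apply_eq_r_of_not_mem_of_perm s ho hr hperm hd₀s hd₀deg hi]
  exact pow_dvd_apply_of_shadeIncreases_of_kept p hj b hbj hbN s ho hr hq hperm hinc hij (hbN i hi)
    hd₀s hd₀deg

/-- **"The center `D` is contained in every `Γ_j`"** (every `e`, every dimension): after an increase of
the shade under a Moh-permissible coordinate centre `C_S`, every variable whose multiplicity is NOT
divisible by `pᵉ` (a `qΓ`-cofactor variable, `q = pᵉ`) is a centre variable — the contrapositive of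
`pow_dvd_r_of_shadeIncreases_of_not_mem`. [cite: HauserPerlega2019PRIMS, §3 Theorem (7)] [cite: Moh1987, §1 (p. 967)] -/
theorem mem_of_shadeIncreases_of_not_pow_dvd {e : ℕ} {S : Finset σ} {j : σ} (hj : j ∈ S)
    (b : σ → K) (hbj : b j = 0) (hbN : ∀ i, i ∉ S → b i = 0) (s : CState σ K) {o : ℕ}
    (ho : ordZero s.F = o) (hr : ∀ d ∈ s.F.support, s.r ≤ d)
    (hq : ∀ d ∈ s.F.support, p ^ e ≤ degIn S d)
    (hperm : ∀ d ∈ s.F.support, degIn S s.r + (o - s.r.degree) ≤ degIn S d)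
    (hinc : ShadeIncreases (p ^ e) S j b s) {i : σ} (hri : ¬ p ^ e ∣ s.r i) : i ∈ S := by
  by_contra hi
  exact hri (pow_dvd_r_of_shadeIncreases_of_not_mem p hj b hbj hbN s ho hr hq hperm hinc hi)

end CentreBlowup

end Literature.AlgebraicGeometry.Resolution

end
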